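import Literature.MathematicalPhysics.QuantumFieldTheory.ConformalBootstrap3D.PointKernelK34L505Data
import Literature.MathematicalPhysics.QuantumFieldTheory.ConformalBootstrap3D.PointKernelK34L505Segs
import Literature.MathematicalPhysics.QuantumFieldTheory.ConformalBootstrap3D.PointKernelParts

/-!
# K34L505 certificate, kernel part file P29: one-cell head segments 97, 98 in level ranges

The head cells whose kernel evaluation exceeds one `decide` are one-cell segments of `hsegsK34L505`; each is
checked by `PCert.hPartSideOK` (side conditions) and `PCert.hPartOK` per level range `[n_lo, n_lo + count)`
against an integer claim, the claims summing to `≥ 0` (`PointKernel.partsOK`); soundness is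
`PCert.hParts_sound` (`PointKernelParts`).  The part files are mutually independent (each imports only
the data file); the ranges of one cell may span several of them, and the per-cell conclusions
`hparts_i` / `hcell_i` of those cells are assembled in `PointKernelK34L505.lean`.
Estimated kernel time 243 s.
-/

set_option maxRecDepth 100000
set_option maxHeartbeats 0

namespace Literature.MathematicalPhysics.QuantumFieldTheory.ConformalBootstrap3D.PointKernelK34L505

open Literature.MathematicalPhysics.QuantumFieldTheory.ConformalBootstrap3D.PointKernel

/-- levels `[71, 73)` of segment 97: partial lower sum `≥` claim. [folklore] -/
theorem part_97_9 : certK34L505.hPartOK (PCert.segAt hsegsK34L505 97) JHK34L505 71 2 (22966272063309227030586444633401381) = true := by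
  decide +kernel

/-- one-cell segment 98 (row 6, cell `[7169/1024, 28677/4096]`, chord, `n_F = 64`,
6 level ranges): side conditions. [folklore] -/
theorem pside_98 : certK34L505.hPartSideOK (PCert.segAt hsegsK34L505 98) JHK34L505 = true := by
  decide +kernel

/-- its level ranges `(n_lo, count, claim)`. [folklore] -/
def partsK34L505_98 : List (ℕ × ℕ × ℤ) := [(0, 28, -22165300715713470362096244418952598845), (28, 12, 15745190188932044934543028804471773116), (40, 9, 4294344508381744099228650009888111772), (49, 7, 1387805219527256631850551612189130389), (56, 5, 500197454327343225357793855062619137), (61, 4, 237763344545081471116220137340964435)]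

/-- the ranges tile `[0, n_F]` and the claims sum to `≥ 0`. [folklore] -/
theorem pcov_98 : PointKernel.partsOK 64 partsK34L505_98 = true := by
  decide +kernel

/-- levels `[0, 28)` of segment 98: partial lower sum `≥` claim. [folklore] -/
theorem part_98_0 : certK34L505.hPartOK (PCert.segAt hsegsK34L505 98) JHK34L505 0 28 (-22165300715713470362096244418952598845) = true := by
  decide +kernel

/-- levels `[28, 40)` of segment 98: partial lower sum `≥` claim. [folklore] -/
theorem part_98_1 : certK34L505.hPartOK (PCert.segAt hsegsK34L505 98) JHK34L505 28 12 (15745190188932044934543028804471773116) = true := by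
  decide +kernel

/-- levels `[40, 49)` of segment 98: partial lower sum `≥` claim. [folklore] -/
theorem part_98_2 : certK34L505.hPartOK (PCert.segAt hsegsK34L505 98) JHK34L505 40 9 (4294344508381744099228650009888111772) = true := by
  decide +kernel

end Literature.MathematicalPhysics.QuantumFieldTheory.ConformalBootstrap3D.PointKernelK34L505
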